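import Literature.NumberTheory.NumberFields.CyclicQuinticField11
import Mathlib.NumberTheory.NumberField.Units.DirichletTheorem
import Mathlib.Topology.Algebra.Polynomial
import Mathlib.Analysis.SpecialFunctions.Pow.Real
import Mathlib.Algebra.Algebra.Rat
import Mathlib.Data.Sign.Basic
import HarnessLib

/-!
# The cyclic quintic field of conductor `11`: real embeddings and units modulo squares

Continuation of `CyclicQuinticField11.lean` (`K = ℚ(θ)`, `θ⁵ + θ⁴ - 4θ³ - 3θ² + 3θ + 1 = 0`,
`σθ = θ² - 2`). Everything is PROVED:

* **The five real roots** `r₀ > r₁ > r₂ > r₃ > r₄` of `f` (`2cos(2πk/11)`, `k = 1, 2, 3, 4, 5`;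
  `r₀ ≈ 1.683, r₁ ≈ 0.831, r₂ ≈ -0.285, r₃ ≈ -1.310, r₄ ≈ -1.919`), located by the intermediate
  value theorem in intervals of width `1/25`, and the fact that they are ALL the real roots
  (`root_cases`: five distinct roots of a quintic); the real embeddings `e k : K →+* ℝ`, `θ ↦ r k`.
* **`σ` permutes the embeddings**: `e k ∘ σ = e (π k)` with `π = (0 ↦ 1 ↦ 3 ↦ 2 ↦ 4 ↦ 0)`
  (`e_σ`), because `r_k² - 2` is again a root (`f(X² - 2) = f(X) g(X)`) lying in the isolating
  interval of `r_{π k}` (`r_sq_sub_two`). Hence `e k (σⁱ θ) = r_{πⁱ k}`: the signs of all conjugates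
  of `θ` at all real places are read off from the signs of the roots (`r₀, r₁ > 0 > r₂, r₃, r₄`).
* **The units `η_i = σⁱθ`** (`i < 5`; `N(η_i) = -1`), with explicit inverses in `ℤ[θ]`
  (`unitη`, `coe_unitη`), their sign vectors `sgnv (unitη i) k = ηSign i k` (`sgnv_unitη`), the
  `32` products `rep n = ∏ η_i^{bit n i}` (`n < 32`) and `sgnv (rep n) = signOf n`, where
  `signOf : Fin 32 → {±1}⁵` is a computable bijection (`signOf_injective` by `decide +kernel`,
  `exists_signOf_eq`: the `5 × 5` sign matrix of the `η_i` is invertible over `𝔽₂`).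
* **`(𝓞 K)ˣ/(𝓞 K)ˣ² ≅ {±1}⁵` by real signs, with representatives `∏ η_i^{b_i}`**: a totally positive
  unit is a square (`exists_sq_eq_of_sgnv_eq_one`: Dirichlet's theorem in Mathlib's form
  `NumberField.Units.exist_unique_eq_mul_prod` gives at most `2 · 2⁴ = 32` classes, and the `rep b`
  realise `32` distinct sign vectors), every unit is `rep n · η²` (`exists_eq_rep_mul_sq`),
  `sgnv (rep n) = 1 → n = 0` (`rep_eq_zero_of_pos`), and `N(rep n) = (-1)^{Σ bit n i}` (`norm_rep`).

This is the `n = 5` analogue of the units section of the tree's `CyclicCubicField13.lean` (signs of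
`±θ^i(θ-1)^j` at three real places); the new point is that the `25` signs are obtained from `5`
root signs and the permutation `π`, not from `25` interval evaluations.

## References

* D. A. Marcus, *Number Fields*, 2nd ed. (2018), Ch. 5, Thm. 38 (Dirichlet's unit theorem) and
  Ch. 2, Exercise 35 (units of `ℤ[ζ_p + ζ_p⁻¹]`). [folklore]
* T. Dokchitser, V. Dokchitser, J. Number Theory 131 (2011) 1833–1839, proof of Thm. 2.
  [DokchitserDokchitser2011RankModN]
-/

noncomputable section

open Polynomial NumberField Algebra

namespace Literature.NumberTheory.NumberFields

namespace CyclicQuintic11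

/-! ### The five real roots -/

/-- The real quintic function `p(x) = x⁵ + x⁴ - 4x³ - 3x² + 3x + 1`. [folklore] -/
def preal (x : ℝ) : ℝ := x ^ 5 + x ^ 4 - 4 * x ^ 3 - 3 * x ^ 2 + 3 * x + 1

/-- `p` is continuous. [folklore] -/
theorem continuous_preal : Continuous preal := by unfold preal; fun_prop

/-- **`x ↦ x² - 2` maps roots to roots**: `p(x² - 2) = p(x) · (x⁵ - x⁴ - 4x³ + 3x² + 3x - 1)`.
[folklore] -/
theorem preal_sq_sub_two (x : ℝ) :
    preal (x ^ 2 - 2) = preal x * (x ^ 5 - x ^ 4 - 4 * x ^ 3 + 3 * x ^ 2 + 3 * x - 1) := by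
  unfold preal; ring

/-- `f` has a real root in each of `(83/50, 17/10)`, `(81/100, 17/20)`, `(-31/100, -13/50)`,
`(-133/100, -129/100)`, `(-97/50, -19/10)` (sign changes of `p` at the end points). [folklore] -/
theorem exists_roots_preal :
    (∃ r, r ∈ Set.Ioo (83 / 50 : ℝ) (17 / 10) ∧ preal r = 0) ∧
    (∃ r, r ∈ Set.Ioo (81 / 100 : ℝ) (17 / 20) ∧ preal r = 0) ∧
    (∃ r, r ∈ Set.Ioo (-31 / 100 : ℝ) (-13 / 50) ∧ preal r = 0) ∧
    (∃ r, r ∈ Set.Ioo (-133 / 100 : ℝ) (-129 / 100) ∧ preal r = 0) ∧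
    (∃ r, r ∈ Set.Ioo (-97 / 50 : ℝ) (-19 / 10) ∧ preal r = 0) := by
  refine ⟨?_, ?_, ?_, ?_, ?_⟩
  · have h := intermediate_value_Ioo (show (83 / 50 : ℝ) ≤ 17 / 10 by norm_num)
      continuous_preal.continuousOn
    have h0 : (0 : ℝ) ∈ Set.Ioo (preal (83 / 50)) (preal (17 / 10)) := by
      simp only [preal, Set.mem_Ioo]; norm_num
    obtain ⟨r, hr, hr0⟩ := h h0
    exact ⟨r, hr, hr0⟩
  · have h := intermediate_value_Ioo' (show (81 / 100 : ℝ) ≤ 17 / 20 by norm_num)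
      continuous_preal.continuousOn
    have h0 : (0 : ℝ) ∈ Set.Ioo (preal (17 / 20)) (preal (81 / 100)) := by
      simp only [preal, Set.mem_Ioo]; norm_num
    obtain ⟨r, hr, hr0⟩ := h h0
    exact ⟨r, hr, hr0⟩
  · have h := intermediate_value_Ioo (show (-31 / 100 : ℝ) ≤ -13 / 50 by norm_num)
      continuous_preal.continuousOn
    have h0 : (0 : ℝ) ∈ Set.Ioo (preal (-31 / 100)) (preal (-13 / 50)) := by
      simp only [preal, Set.mem_Ioo]; norm_num
    obtain ⟨r, hr, hr0⟩ := h h0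
    exact ⟨r, hr, hr0⟩
  · have h := intermediate_value_Ioo' (show (-133 / 100 : ℝ) ≤ -129 / 100 by norm_num)
      continuous_preal.continuousOn
    have h0 : (0 : ℝ) ∈ Set.Ioo (preal (-129 / 100)) (preal (-133 / 100)) := by
      simp only [preal, Set.mem_Ioo]; norm_num
    obtain ⟨r, hr, hr0⟩ := h h0
    exact ⟨r, hr, hr0⟩
  · have h := intermediate_value_Ioo (show (-97 / 50 : ℝ) ≤ -19 / 10 by norm_num)
      continuous_preal.continuousOn
    have h0 : (0 : ℝ) ∈ Set.Ioo (preal (-97 / 50)) (preal (-19 / 10)) := by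
      simp only [preal, Set.mem_Ioo]; norm_num
    obtain ⟨r, hr, hr0⟩ := h h0
    exact ⟨r, hr, hr0⟩

/-- The root `r₀ ∈ (1.66, 1.70)` (`= 2cos(2π/11) ≈ 1.6825`). [folklore] -/
def r₀ : ℝ := Classical.choose exists_roots_preal.1
/-- The root `r₁ ∈ (0.81, 0.85)` (`= 2cos(4π/11) ≈ 0.8308`). [folklore] -/
def r₁ : ℝ := Classical.choose exists_roots_preal.2.1
/-- The root `r₂ ∈ (-0.31, -0.26)` (`= 2cos(6π/11) ≈ -0.2846`). [folklore] -/
def r₂ : ℝ := Classical.choose exists_roots_preal.2.2.1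
/-- The root `r₃ ∈ (-1.33, -1.29)` (`= 2cos(8π/11) ≈ -1.3097`). [folklore] -/
def r₃ : ℝ := Classical.choose exists_roots_preal.2.2.2.1
/-- The root `r₄ ∈ (-1.94, -1.90)` (`= 2cos(10π/11) ≈ -1.9190`). [folklore] -/
def r₄ : ℝ := Classical.choose exists_roots_preal.2.2.2.2

/-- `r₀ ∈ (83/50, 17/10)`, `p(r₀) = 0`. [folklore] -/
theorem r₀_spec : r₀ ∈ Set.Ioo (83 / 50 : ℝ) (17 / 10) ∧ preal r₀ = 0 :=
  Classical.choose_spec exists_roots_preal.1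
/-- `r₁ ∈ (81/100, 17/20)`, `p(r₁) = 0`. [folklore] -/
theorem r₁_spec : r₁ ∈ Set.Ioo (81 / 100 : ℝ) (17 / 20) ∧ preal r₁ = 0 :=
  Classical.choose_spec exists_roots_preal.2.1
/-- `r₂ ∈ (-31/100, -13/50)`, `p(r₂) = 0`. [folklore] -/
theorem r₂_spec : r₂ ∈ Set.Ioo (-31 / 100 : ℝ) (-13 / 50) ∧ preal r₂ = 0 :=
  Classical.choose_spec exists_roots_preal.2.2.1
/-- `r₃ ∈ (-133/100, -129/100)`, `p(r₃) = 0`. [folklore] -/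
theorem r₃_spec : r₃ ∈ Set.Ioo (-133 / 100 : ℝ) (-129 / 100) ∧ preal r₃ = 0 :=
  Classical.choose_spec exists_roots_preal.2.2.2.1
/-- `r₄ ∈ (-97/50, -19/10)`, `p(r₄) = 0`. [folklore] -/
theorem r₄_spec : r₄ ∈ Set.Ioo (-97 / 50 : ℝ) (-19 / 10) ∧ preal r₄ = 0 :=
  Classical.choose_spec exists_roots_preal.2.2.2.2

/-- The five real roots as a family `r : Fin 5 → ℝ`, in decreasing order. [folklore] -/
def r : Fin 5 → ℝ := ![r₀, r₁, r₂, r₃, r₄]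

/-- `r 0 = r₀`. [folklore] -/
@[simp] theorem r_0 : r 0 = r₀ := rfl
/-- `r 1 = r₁`. [folklore] -/
@[simp] theorem r_1 : r 1 = r₁ := rfl
/-- `r 2 = r₂`. [folklore] -/
@[simp] theorem r_2 : r 2 = r₂ := rfl
/-- `r 3 = r₃`. [folklore] -/
@[simp] theorem r_3 : r 3 = r₃ := rfl
/-- `r 4 = r₄`. [folklore] -/
@[simp] theorem r_4 : r 4 = r₄ := rfl

/-- Each `r k` is a root of `p`. [folklore] -/
theorem preal_r (k : Fin 5) : preal (r k) = 0 := by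
  fin_cases k
  exacts [r₀_spec.2, r₁_spec.2, r₂_spec.2, r₃_spec.2, r₄_spec.2]

/-- The explicit real polynomial `P = X⁵ + X⁴ - 4X³ - 3X² + 3X + 1 ∈ ℝ[X]` with `P(x) = p(x)`.
[folklore] -/
def Preal : ℝ[X] := X ^ 5 + X ^ 4 - 4 * X ^ 3 - 3 * X ^ 2 + 3 * X + 1

/-- `P(x) = p(x)`. [folklore] -/
theorem eval_Preal (x : ℝ) : Preal.eval x = preal x := by
  simp only [Preal, preal, eval_add, eval_sub, eval_mul, eval_pow, eval_X, eval_ofNat, eval_one]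

/-- `deg P = 5`. [folklore] -/
theorem natDegree_Preal : Preal.natDegree = 5 := by
  unfold Preal; compute_degree!

/-- `P ≠ 0`. [folklore] -/
theorem Preal_ne_zero : Preal ≠ 0 := fun h => by
  have := natDegree_Preal; rw [h, natDegree_zero] at this; exact absurd this (by norm_num)

/-- **The five roots are all the real roots of `f`**: a real root of `p` is one of `r₀, …, r₄`
(five distinct roots of a polynomial of degree `5`). [folklore] -/
theorem root_cases {x : ℝ} (hx : preal x = 0) : x = r₀ ∨ x = r₁ ∨ x = r₂ ∨ x = r₃ ∨ x = r₄ := by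
  classical
  have h0 := r₀_spec.1; have h1 := r₁_spec.1; have h2 := r₂_spec.1; have h3 := r₃_spec.1
  have h4 := r₄_spec.1
  simp only [Set.mem_Ioo] at h0 h1 h2 h3 h4
  set S : Finset ℝ := {r₀, r₁, r₂, r₃, r₄} with hS
  have hScard : S.card = 5 := by
    rw [hS, Finset.card_insert_of_notMem, Finset.card_insert_of_notMem,
      Finset.card_insert_of_notMem, Finset.card_insert_of_notMem, Finset.card_singleton]
    · rw [Finset.mem_singleton]; linarith
    · simp only [Finset.mem_insert, Finset.mem_singleton, not_or]; constructor <;> linarith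
    · simp only [Finset.mem_insert, Finset.mem_singleton, not_or]
      refine ⟨?_, ?_, ?_⟩ <;> linarith
    · simp only [Finset.mem_insert, Finset.mem_singleton, not_or]
      refine ⟨?_, ?_, ?_, ?_⟩ <;> linarith
  have hmem : ∀ y, preal y = 0 → y ∈ Preal.roots.toFinset := fun y hy => by
    rw [Multiset.mem_toFinset, mem_roots Preal_ne_zero, IsRoot.def, eval_Preal]; exact hy
  have hsub : S ⊆ Preal.roots.toFinset := by
    intro y hy
    simp only [hS, Finset.mem_insert, Finset.mem_singleton] at hy
    rcases hy with rfl | rfl | rfl | rfl | rfl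
    exacts [hmem _ r₀_spec.2, hmem _ r₁_spec.2, hmem _ r₂_spec.2, hmem _ r₃_spec.2,
      hmem _ r₄_spec.2]
  have hcard : Preal.roots.toFinset.card ≤ S.card := by
    rw [hScard, ← natDegree_Preal]
    exact (Multiset.toFinset_card_le _).trans (Polynomial.card_roots' _)
  have heq : S = Preal.roots.toFinset := Finset.eq_of_subset_of_card_le hsub hcard
  have hxS : x ∈ S := by rw [heq]; exact hmem x hx
  simpa [hS] using hxS

/-! ### The permutation `π` of the roots induced by `x ↦ x² - 2` -/

/-- **`x ↦ x² - 2` permutes the roots as `r₀ ↦ r₁ ↦ r₃ ↦ r₂ ↦ r₄ ↦ r₀`** (the Galois action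
`ζ ↦ ζ²` on `2cos(2πk/11)`: `k ↦ 2k`); as a map on indices. [folklore] -/
def πσ : Fin 5 → Fin 5 := ![1, 3, 4, 2, 0]

/-- **`r_k² - 2 = r_{π k}`**: `r_k² - 2` is a root of `p` (`preal_sq_sub_two`) and lies in the
isolating interval of `r_{π k}` (interval arithmetic on the root enclosures), and the five roots
are all the roots (`root_cases`). [folklore] -/
theorem r_sq_sub_two (k : Fin 5) : r k ^ 2 - 2 = r (πσ k) := by
  have h0 := r₀_spec.1; have h1 := r₁_spec.1; have h2 := r₂_spec.1; have h3 := r₃_spec.1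
  have h4 := r₄_spec.1
  simp only [Set.mem_Ioo] at h0 h1 h2 h3 h4
  have hroot : preal (r k ^ 2 - 2) = 0 := by rw [preal_sq_sub_two, preal_r, zero_mul]
  fin_cases k <;>
    simp only [r, πσ, Fin.zero_eta, Fin.mk_one, Fin.reduceFinMk, Matrix.cons_val_zero,
      Matrix.cons_val_one, Matrix.cons_val, Fin.isValue] at hroot ⊢ <;>
    rcases root_cases hroot with h | h | h | h | h <;>
    first | exact h | (exfalso; nlinarith)

/-! ### The five real embeddings -/

/-- A real root of `p` is a root of `quinticPolyRat` under `ℚ → ℝ`. [folklore] -/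
theorem eval₂_quinticPolyRat_real {x : ℝ} (hx : preal x = 0) :
    quinticPolyRat.eval₂ (algebraMap ℚ ℝ) x = 0 := by
  rw [eval₂_map, quinticPoly]
  simp only [eval₂_add, eval₂_sub, eval₂_mul, eval₂_X_pow, eval₂_X, eval₂_ofNat, eval₂_one,
    map_ofNat, map_one]
  exact hx

/-- **The real embedding `e k : K → ℝ`, `θ ↦ r k`.** [folklore] -/
def e (k : Fin 5) : K →+* ℝ := AdjoinRoot.lift (algebraMap ℚ ℝ) (r k) (eval₂_quinticPolyRat_real (preal_r k))

/-- `e k θ = r k`. [folklore] -/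
@[simp] theorem e_θ (k : Fin 5) : e k θ = r k := AdjoinRoot.lift_root _

/-- The roots are pairwise distinct (strictly decreasing in the index). [folklore] -/
theorem r_injective : Function.Injective r := by
  have h0 := r₀_spec.1; have h1 := r₁_spec.1; have h2 := r₂_spec.1; have h3 := r₃_spec.1
  have h4 := r₄_spec.1
  simp only [Set.mem_Ioo] at h0 h1 h2 h3 h4
  intro i j hij
  fin_cases i <;> fin_cases j <;> first | rfl | (exfalso; simp [r] at hij; linarith)

/-- The five real embeddings are pairwise distinct (they separate `θ`). [folklore] -/
theorem e_injective : Function.Injective e := fun i j hij =>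
  r_injective (by rw [← e_θ, ← e_θ, hij])

/-- A ring homomorphism `K = ℚ(θ) → ℝ` is determined by the image of `θ`. [folklore] -/
theorem ringHom_ext {g h : K →+* ℝ} (hgh : g θ = h θ) : g = h := by
  have : (g.toRatAlgHom : K →ₐ[ℚ] ℝ) = h.toRatAlgHom := AdjoinRoot.algHom_ext (by exact hgh)
  have := congrArg (fun f : K →ₐ[ℚ] ℝ => (f : K →+* ℝ)) this
  simpa using this

/-- **`σ` permutes the real embeddings: `e k ∘ σ = e (π k)`** (`e k (σθ) = r_k² - 2 = r_{π k}`).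
[folklore] -/
theorem e_comp_σ (k : Fin 5) : (e k).comp (σ : K →+* K) = e (πσ k) :=
  ringHom_ext (by
    rw [RingHom.comp_apply, RingHom.coe_coe, σ_θ, map_sub, map_pow, e_θ, map_ofNat, e_θ,
      r_sq_sub_two])

/-- `e k (σ x) = e (π k) x`. [folklore] -/
theorem e_σ (k : Fin 5) (x : K) : e k (σ x) = e (πσ k) x := by
  have := congrArg (fun f : K →+* ℝ => f x) (e_comp_σ k)
  simpa using this

/-- `e k (σⁱ x) = e (πⁱ k) x`. [folklore] -/
theorem e_σ_iterate (n : ℕ) (k : Fin 5) (x : K) : e k (σ^[n] x) = e (πσ^[n] k) x := by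
  induction n generalizing k with
  | zero => rfl
  | succ n ih => rw [Function.iterate_succ_apply', e_σ, ih, Function.iterate_succ_apply]

/-- The signs of the roots: `r₀, r₁ > 0 > r₂, r₃, r₄`; `negRoot j` records `r j < 0`. [folklore] -/
def negRoot : Fin 5 → Bool := ![false, false, true, true, true]

/-- `sign (r j) = -1` if `negRoot j`, else `1`. [folklore] -/
theorem sign_r (j : Fin 5) : SignType.sign (r j) = if negRoot j then -1 else 1 := by
  have h0 := r₀_spec.1; have h1 := r₁_spec.1; have h2 := r₂_spec.1; have h3 := r₃_spec.1
  have h4 := r₄_spec.1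
  simp only [Set.mem_Ioo] at h0 h1 h2 h3 h4
  fin_cases j <;> simp only [r, negRoot, Fin.zero_eta, Fin.mk_one, Fin.reduceFinMk, Fin.isValue,
    Matrix.cons_val_zero, Matrix.cons_val_one, Matrix.cons_val]
  · exact sign_pos (by linarith)
  · exact sign_pos (by linarith)
  · exact sign_neg (by linarith)
  · exact sign_neg (by linarith)
  · exact sign_neg (by linarith)

/-! ### The units `η_i = σⁱ θ` and their signs -/

/-- `η₁ = σθ = θ² - 2`, with inverse `θ - 3θ² + θ⁴`. [folklore] -/
def unitη₁ : (𝓞 K)ˣ :=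
  Units.mkOfMulEqOne (θint ^ 2 - 2) (θint - 3 * θint ^ 2 + θint ^ 4)
    (by linear_combination (-1 + θint) * θint_rel)

/-- `η₂ = σ²θ = θ⁴ - 4θ² + 2`, with inverse `-3θ - 3θ² + θ³ + θ⁴`. [folklore] -/
def unitη₂ : (𝓞 K)ˣ :=
  Units.mkOfMulEqOne (θint ^ 4 - 4 * θint ^ 2 + 2) (-3 * θint - 3 * θint ^ 2 + θint ^ 3 + θint ^ 4)
    (by linear_combination (-1 - 3 * θint + θint ^ 3) * θint_rel)

/-- `η₃ = σ³θ = θ³ - 3θ`, with inverse `1 - θ - θ²`. [folklore] -/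
def unitη₃ : (𝓞 K)ˣ :=
  Units.mkOfMulEqOne (θint ^ 3 - 3 * θint) (1 - θint - θint ^ 2)
    (by linear_combination (-1 : 𝓞 K) * θint_rel)

/-- `η₄ = σ⁴θ = -θ⁴ - θ³ + 3θ² + 2θ - 1`, with inverse `-1 + 3θ² - θ⁴`. [folklore] -/
def unitη₄ : (𝓞 K)ˣ :=
  Units.mkOfMulEqOne (-θint ^ 4 - θint ^ 3 + 3 * θint ^ 2 + 2 * θint - 1) (-1 + 3 * θint ^ 2 - θint ^ 4)
    (by linear_combination (-2 * θint + θint ^ 3) * θint_rel)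

/-- **The units `η_i = σⁱθ`, `i < 5`**, as a family (`η₀ = θ`). [folklore] -/
def unitη : Fin 5 → (𝓞 K)ˣ := ![unitθ, unitη₁, unitη₂, unitη₃, unitη₄]

/-- `η_i = σⁱ θ` in `K`. [folklore] -/
theorem coe_unitη (i : Fin 5) : (((unitη i : (𝓞 K)ˣ) : 𝓞 K) : K) = σ^[i] θ := by
  fin_cases i
  · rfl
  · simp only [unitη, unitη₁, Fin.mk_one, Fin.isValue, Matrix.cons_val_one, Matrix.cons_val_zero,
      Units.val_mkOfMulEqOne, Function.iterate_one, σ_θ]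
    simp only [map_sub, map_pow, map_ofNat, coe_θint]
  · simp only [unitη, unitη₂, Fin.reduceFinMk, Matrix.cons_val, Units.val_mkOfMulEqOne,
      Function.iterate_succ_apply', Function.iterate_zero_apply, σ_σ_θ]
    simp only [map_sub, map_add, map_mul, map_pow, map_ofNat, coe_θint]
  · simp only [unitη, unitη₃, Fin.reduceFinMk, Matrix.cons_val, Units.val_mkOfMulEqOne,
      Function.iterate_succ_apply', Function.iterate_zero_apply, σ_pow_three_θ]
    simp only [map_sub, map_mul, map_pow, map_ofNat, coe_θint]
  · simp only [unitη, unitη₄, Fin.reduceFinMk, Matrix.cons_val, Units.val_mkOfMulEqOne,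
      Function.iterate_succ_apply', Function.iterate_zero_apply, σ_pow_four_θ]
    simp only [map_sub, map_add, map_neg, map_mul, map_pow, map_ofNat, map_one, coe_θint]

/-- **The sign vector** of a unit at the five real embeddings. [folklore] -/
def sgnv (y : (𝓞 K)ˣ) : Fin 5 → SignType := fun k => SignType.sign (e k ((y : 𝓞 K) : K))

/-- The sign vector is multiplicative. [folklore] -/
theorem sgnv_mul (y z : (𝓞 K)ˣ) : sgnv (y * z) = sgnv y * sgnv z := by
  ext k; simp only [sgnv, Units.val_mul, map_mul, sign_mul, Pi.mul_apply]

/-- `sgnv 1 = 1`. [folklore] -/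
theorem sgnv_one : sgnv 1 = 1 := by
  ext k; simp [sgnv]

/-- `sgnv` as a monoid homomorphism. [folklore] -/
def sgnvHom : (𝓞 K)ˣ →* (Fin 5 → SignType) where
  toFun := sgnv
  map_one' := sgnv_one
  map_mul' := sgnv_mul

/-- `sgnvHom` is `sgnv`. [folklore] -/
@[simp] theorem sgnvHom_apply (y : (𝓞 K)ˣ) : sgnvHom y = sgnv y := rfl

/-- A real embedding does not vanish on units. [folklore] -/
theorem emb_units_ne_zero (g : K →+* ℝ) (y : (𝓞 K)ˣ) : g ((y : 𝓞 K) : K) ≠ 0 :=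
  (map_ne_zero g).mpr (RingOfIntegers.coe_ne_zero_iff.mpr (Units.ne_zero y))

/-- Squares of units are totally positive: `sgnv (η²) = 1`. [folklore] -/
theorem sgnv_sq (η : (𝓞 K)ˣ) : sgnv (η ^ 2) = 1 := by
  ext k
  have hc : (((η ^ 2 : (𝓞 K)ˣ) : 𝓞 K) : K) = (((η : (𝓞 K)ˣ) : 𝓞 K) : K) ^ 2 := by
    rw [Units.val_pow_eq_pow_val]; push_cast; rfl
  simp only [sgnv, hc, map_pow, Pi.one_apply]
  exact sign_pos (lt_of_le_of_ne (sq_nonneg _) (Ne.symm (pow_ne_zero 2 (emb_units_ne_zero _ η))))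

/-- Each coordinate of a sign vector of a unit is `±1`. [folklore] -/
theorem sgnv_eq_one_or (x : (𝓞 K)ˣ) (k : Fin 5) : sgnv x k = 1 ∨ sgnv x k = -1 := by
  rcases lt_or_gt_of_ne (emb_units_ne_zero (e k) x) with h | h
  · exact Or.inr (sign_neg h)
  · exact Or.inl (sign_pos h)

/-- The predicted sign of `η_i` at the place `k`: `-1` iff `r_{πⁱ k} < 0`. [folklore] -/
def ηSign (i k : Fin 5) : SignType := if negRoot (πσ^[i] k) then -1 else 1

/-- **The signs of the units `η_i`**: `sgnv (η_i) k = sign (e k (σⁱθ)) = sign (r_{πⁱ k})`.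
[folklore] -/
theorem sgnv_unitη (i k : Fin 5) : sgnv (unitη i) k = ηSign i k := by
  rw [sgnv, coe_unitη, e_σ_iterate, e_θ, sign_r, ηSign]

/-- The `i`-th binary digit of `n < 32` (exponent of `η_i` in the `n`-th representative). [folklore] -/
def bit (n : Fin 32) (i : Fin 5) : ℕ := (n : ℕ) / 2 ^ (i : ℕ) % 2

/-- The `32` representatives `rep n = ∏ η_i^{bit n i}`, `n < 32`. [folklore] -/
def rep (n : Fin 32) : (𝓞 K)ˣ := ∏ i, unitη i ^ bit n i

/-- The predicted sign vector of `rep n` (computable). [folklore] -/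
def signOf (n : Fin 32) (k : Fin 5) : SignType := ∏ i, ηSign i k ^ bit n i

/-- **`sgnv (rep n) = signOf n`.** [folklore] -/
theorem sgnv_rep (n : Fin 32) : sgnv (rep n) = signOf n := by
  ext k
  rw [rep, ← sgnvHom_apply, map_prod, Finset.prod_apply]
  simp only [map_pow, Pi.pow_apply, sgnvHom_apply, sgnv_unitη, signOf]

/-- **The sign matrix of the `η_i` is invertible over `𝔽₂`**: `signOf` is injective on the `32`
exponent patterns (by kernel computation over the `32 × 32` pairs). [folklore] -/
theorem signOf_injective : Function.Injective signOf := by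
  have h : ∀ n m : Fin 32, signOf n = signOf m → n = m := by decide +kernel
  exact fun n m hnm => h n m hnm

/-- Every entry of `signOf n` is `±1`. [folklore] -/
theorem signOf_eq_one_or (n : Fin 32) (k : Fin 5) : signOf n k = 1 ∨ signOf n k = -1 := by
  revert n k
  decide +kernel

/-- `signOf 0 = 1`, hence `signOf n = 1 → n = 0`. [folklore] -/
theorem eq_zero_of_signOf_eq_one {n : Fin 32} (h : signOf n = 1) : n = 0 :=
  signOf_injective (h.trans (by decide +kernel))

/-- The `±1`-vector with negative entries where `c` is `true`. [folklore] -/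
def vecOfBool (c : Fin 5 → Bool) : Fin 5 → SignType := fun k => if c k then -1 else 1

/-- `vecOfBool` is injective. [folklore] -/
theorem vecOfBool_injective : Function.Injective vecOfBool := by
  intro c c' h
  ext k
  have := congrArg (fun v => v k) h
  simp only [vecOfBool] at this
  cases hc : c k <;> cases hc' : c' k <;> simp_all

/-- A `±1`-vector is a `vecOfBool`. [folklore] -/
theorem exists_vecOfBool_eq (v : Fin 5 → SignType) (hv : ∀ k, v k = 1 ∨ v k = -1) :
    ∃ c, vecOfBool c = v :=
  ⟨fun k => decide (v k = -1), funext fun k => by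
    rcases hv k with h | h <;> simp [vecOfBool, h]⟩

/-- **Every `±1`-vector is a `signOf n`** (`signOf` is injective on `32` patterns, its values are
among the `32` `±1`-vectors). [folklore] -/
theorem exists_signOf_eq (v : Fin 5 → SignType) (hv : ∀ k, v k = 1 ∨ v k = -1) :
    ∃ n : Fin 32, signOf n = v := by
  classical
  have hsub : Finset.univ.image signOf ⊆ Finset.univ.image vecOfBool := by
    intro w hw
    rw [Finset.mem_image] at hw ⊢
    obtain ⟨n, -, rfl⟩ := hw
    obtain ⟨c, hc⟩ := exists_vecOfBool_eq (signOf n) (signOf_eq_one_or n)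
    exact ⟨c, Finset.mem_univ c, hc⟩
  have hcard : (Finset.univ.image vecOfBool).card ≤ (Finset.univ.image signOf).card := by
    rw [Finset.card_image_of_injective _ vecOfBool_injective,
      Finset.card_image_of_injective _ signOf_injective]
    simp
  have heq := Finset.eq_of_subset_of_card_le hsub hcard
  obtain ⟨c, hc⟩ := exists_vecOfBool_eq v hv
  have hmem : v ∈ Finset.univ.image signOf := by
    rw [heq, Finset.mem_image]; exact ⟨c, Finset.mem_univ c, hc⟩
  obtain ⟨n, -, hn⟩ := Finset.mem_image.mp hmem
  exact ⟨n, hn⟩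

/-! ### Units modulo squares: `(𝓞 K)ˣ/(𝓞 K)ˣ² ≅ {±1}⁵` via real signs -/

/-- For a quintic field the unit rank `r₁ + r₂ - 1` is at most `4` (`r₁ + 2r₂ = 5`). [folklore] -/
theorem units_rank_le_four : Units.rank K ≤ 4 := by
  have h1 := InfinitePlace.card_add_two_mul_card_eq_rank K
  have h2 := InfinitePlace.card_eq_nrRealPlaces_add_nrComplexPlaces K
  rw [finrank_K] at h1
  rw [Units.rank, h2]
  omega

/-- **Units modulo squares (Dirichlet).** Every unit is `ρ(e) η²` where
`ρ(s, ε) = (-1)^s ∏ᵢ εᵢ^{εᵢ'}` over Mathlib's fundamental system `εᵢ` (`i < rank K`), with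
`s, εᵢ' ∈ {0, 1}` (`NumberField.Units.exist_unique_eq_mul_prod`, torsion `= ±1` in odd degree).
(Verbatim the tree's `CyclicCubic13.exists_rep_mul_sq`.) [folklore] -/
theorem exists_fund_rep_mul_sq (x : (𝓞 K)ˣ) :
    ∃ (s : Fin 2) (ε : Fin (Units.rank K) → Fin 2) (η : (𝓞 K)ˣ),
      x = ((-1) ^ (s : ℕ) * ∏ i, Units.fundSystem K i ^ ((ε i : ℕ))) * η ^ 2 := by
  classical
  obtain ⟨⟨ζ, e⟩, hx, -⟩ := Units.exist_unique_eq_mul_prod K x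
  have hodd : Odd (Module.finrank ℚ K) := by rw [finrank_K]; decide
  refine ⟨if ((ζ : (𝓞 K)ˣ) = 1) then 0 else 1, fun i => ⟨(e i % 2).toNat, by omega⟩,
    ∏ i, Units.fundSystem K i ^ (e i / 2), ?_⟩
  have hsplit : ∀ i, Units.fundSystem K i ^ e i =
      Units.fundSystem K i ^ (((⟨(e i % 2).toNat, by omega⟩ : Fin 2) : ℕ)) *
        (Units.fundSystem K i ^ (e i / 2)) ^ 2 := by
    intro i
    rw [← zpow_natCast, ← zpow_natCast (Units.fundSystem K i ^ (e i / 2)) 2, ← zpow_mul,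
      ← zpow_add]
    congr 1
    push_cast
    rw [Int.toNat_of_nonneg (Int.emod_nonneg _ two_ne_zero)]
    omega
  rw [← Finset.prod_pow, mul_assoc, ← Finset.prod_mul_distrib]
  simp_rw [← hsplit]
  rcases Units.torsion_eq_one_or_neg_one_of_odd_finrank hodd ζ with hζ | hζ
  · rw [if_pos hζ]
    simp only [Fin.val_zero, pow_zero, one_mul]
    rw [hζ, one_mul] at hx
    exact hx
  · have hne : (ζ : (𝓞 K)ˣ) ≠ 1 := by
      rw [hζ]
      intro h
      have h' := congrArg (fun u : (𝓞 K)ˣ => (u : 𝓞 K)) h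
      simp only [Units.val_neg, Units.val_one] at h'
      norm_num at h'
    rw [if_neg hne]
    simp only [Fin.val_one, pow_one]
    rw [hζ] at hx
    exact hx

/-- **A totally positive unit is a square.** By Dirichlet every unit is `ρ(e) η²` for one of at
most `2 · 2^{rank K} ≤ 32` elements `ρ(e)`; the units `∏ η_i^{b_i}` realise `32` distinct sign
vectors, so `sgnv ∘ ρ` is injective, and `sgnv x = 1` forces `ρ(e) = 1`. [folklore] -/
theorem exists_sq_eq_of_sgnv_eq_one (x : (𝓞 K)ˣ) (hx : sgnv x = 1) : ∃ η : (𝓞 K)ˣ, x = η ^ 2 := by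
  classical
  set F := Units.fundSystem K with hF
  let E := Fin 2 × (Fin (Units.rank K) → Fin 2)
  let ρ : E → (𝓞 K)ˣ := fun e => (-1) ^ (e.1 : ℕ) * ∏ i, F i ^ ((e.2 i : ℕ))
  have hρ0 : ρ (0, fun _ => 0) = 1 := by simp [ρ]
  have hcardE : Fintype.card E ≤ 32 := by
    have hr := units_rank_le_four
    simp only [E, Fintype.card_prod, Fintype.card_fun, Fintype.card_fin]
    calc 2 * 2 ^ Units.rank K ≤ 2 * 2 ^ 4 :=
          Nat.mul_le_mul_left 2 (Nat.pow_le_pow_right (by norm_num) hr)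
      _ = 32 := by norm_num
  -- the 32 sign vectors of the `rep b`
  let T : Finset (Fin 5 → SignType) := Finset.univ.image signOf
  have hTcard : T.card = 32 := by
    rw [Finset.card_image_of_injective _ signOf_injective]
    simp
  have hred : ∀ y : (𝓞 K)ˣ, ∃ e : E, sgnv y = sgnv (ρ e) := by
    intro y
    obtain ⟨s, ε, η, hy⟩ := exists_fund_rep_mul_sq y
    exact ⟨(s, ε), by rw [hy, sgnv_mul, sgnv_sq, mul_one]⟩
  have hsurjT : T ⊆ Finset.univ.image (sgnv ∘ ρ) := by
    intro v hv
    rw [Finset.mem_image] at hv ⊢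
    obtain ⟨n, -, rfl⟩ := hv
    obtain ⟨e, he⟩ := hred (rep n)
    exact ⟨e, Finset.mem_univ e, by rw [Function.comp_apply, ← he, sgnv_rep]⟩
  have hinj : Set.InjOn (sgnv ∘ ρ) (Finset.univ : Finset E) := by
    rw [← Finset.card_image_iff]
    apply le_antisymm Finset.card_image_le
    calc (Finset.univ : Finset E).card = Fintype.card E := Finset.card_univ
      _ ≤ 32 := hcardE
      _ = T.card := hTcard.symm
      _ ≤ (Finset.univ.image (sgnv ∘ ρ)).card := Finset.card_le_card hsurjT
  obtain ⟨s, ε, η, hxe⟩ := exists_fund_rep_mul_sq x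
  have hρe : sgnv (ρ (s, ε)) = sgnv (ρ (0, fun _ => 0)) := by
    rw [hρ0, sgnv_one]
    have : sgnv x = sgnv (ρ (s, ε)) := by rw [hxe, sgnv_mul, sgnv_sq, mul_one]
    rw [← this, hx]
  have he0 : (s, ε) = (0, fun _ => 0) := hinj (Finset.mem_univ _) (Finset.mem_univ _) hρe
  refine ⟨η, ?_⟩
  rw [hxe, show ((-1) ^ (s : ℕ) * ∏ i, F i ^ ((ε i : ℕ)) : (𝓞 K)ˣ) = ρ (s, ε) from rfl, he0, hρ0,
    one_mul]

/-- Group-theoretic bookkeeping: `x R = η²` gives `x = R (η R⁻¹)²`. [folklore] -/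
theorem eq_mul_sq_of_mul_eq_sq' {G : Type*} [CommGroup G] {x R η : G} (h : x * R = η ^ 2) :
    x = R * (η * R⁻¹) ^ 2 := by
  rw [mul_pow, inv_pow, ← h, ← mul_assoc, mul_comm R (x * R), mul_assoc x R R, ← pow_two,
    mul_inv_cancel_right]

/-- **Every unit of `K` is `∏ η_i^{b_i}` times a square** (`b ∈ {0,1}⁵`): the representative with the
same sign vector as `x` differs from `x` by a totally positive unit, a square. [folklore] -/
theorem exists_eq_rep_mul_sq (x : (𝓞 K)ˣ) : ∃ (n : Fin 32) (η : (𝓞 K)ˣ), x = rep n * η ^ 2 := by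
  obtain ⟨n, hn⟩ := exists_signOf_eq (sgnv x) (sgnv_eq_one_or x)
  have hsq : sgnv (x * rep n) = 1 := by
    rw [sgnv_mul, sgnv_rep, hn]
    ext k
    rcases sgnv_eq_one_or x k with h | h <;> simp [h]
  obtain ⟨η, hη⟩ := exists_sq_eq_of_sgnv_eq_one _ hsq
  exact ⟨n, η * (rep n)⁻¹, eq_mul_sq_of_mul_eq_sq' hη⟩

/-- **A representative that is positive at every real place is trivial**: if `e k (rep b) > 0` for
all `k` then `b = 0`. [folklore] -/
theorem rep_eq_zero_of_pos {n : Fin 32} (h : ∀ k, 0 < e k (((rep n : (𝓞 K)ˣ) : 𝓞 K) : K)) :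
    n = 0 := by
  apply eq_zero_of_signOf_eq_one
  rw [← sgnv_rep]
  ext k
  exact sign_pos (h k)

/-! ### Norms of the representatives -/

/-- `N(σ x) = N(x)`. [folklore] -/
theorem norm_σ (x : K) : Algebra.norm ℚ (σ x) = Algebra.norm ℚ x := by
  classical
  apply (algebraMap ℚ K).injective
  rw [Algebra.norm_eq_prod_automorphisms, Algebra.norm_eq_prod_automorphisms]
  simp_rw [← AlgEquiv.mul_apply]
  exact Fintype.prod_equiv (Equiv.mulRight σ) _ _ fun _ => rfl

/-- `N(σⁱ x) = N(x)`. [folklore] -/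
theorem norm_σ_iterate (n : ℕ) (x : K) : Algebra.norm ℚ (σ^[n] x) = Algebra.norm ℚ x := by
  induction n with
  | zero => rfl
  | succ n ih => rw [Function.iterate_succ_apply', norm_σ, ih]

/-- `N(η_i) = -1`. [folklore] -/
theorem norm_unitη (i : Fin 5) : Algebra.norm ℚ (((unitη i : (𝓞 K)ˣ) : 𝓞 K) : K) = -1 := by
  rw [coe_unitη, norm_σ_iterate, norm_θ]

/-- **`N(∏ η_i^{b_i}) = (-1)^{Σ b_i}`.** [folklore] -/
theorem norm_rep (n : Fin 32) :
    Algebra.norm ℚ (((rep n : (𝓞 K)ˣ) : 𝓞 K) : K) = (-1) ^ (∑ i, bit n i) := by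
  rw [rep, Units.coe_prod]
  push_cast
  rw [map_prod, ← Finset.prod_pow_eq_pow_sum]
  refine Finset.prod_congr rfl fun i _ => ?_
  rw [map_pow, norm_unitη]

end CyclicQuintic11

end Literature.NumberTheory.NumberFields

end
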